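import Summits.QuantumFields.QCD.Theorems.SpectralDefectExtinctionWindowExtinctionStubInertiaMonotoneAux
import Summits.QuantumFields.QCD.Theorems.WindowExtinction.Negative.SpectralFlowLocal
import Mathlib.Topology.Instances.Matrix
import Mathlib.Algebra.Order.Chebyshev
import HarnessLib

/-!
# Lower semicontinuity of the negative count, with a uniform tube over a compact probe interval
# (stub `stub_negCountOpen`)

Stub `stub_negCountOpen` (S9) of line `free-volume-heavy-witness` (reshape r4) of crux
`Summit.QuantumFields.QCD.Theses.SpectralDefectExtinction.WindowExtinction`
(item stmt-QuantumFields-8964).  Abstract statement (pure topology + min–max, no lattice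
vocabulary): for a jointly continuous family `F x s` of Hermitian matrices and a point `x₀` with
`n₋(F x₀ s) ≥ θ` for all `s ∈ [lo, hi]`, some open `V ∋ x₀` has `n₋(F x s) ≥ θ` for all `x ∈ V` and
all `s ∈ [lo, hi]`; here `n₋ = negRootCount` (roots of the characteristic polynomial with negative
real part, `ExtinctionBuildsQCD/Negative/InertiaPencil.lean`).

* `negCountOpen_abs_form_le` — an entrywise bound `‖D i j‖ ≤ η` gives the form bound
  `|Re⟨v, D v⟩| ≤ η · #n · Σ‖v i‖²` (triangle inequality + `(Σ‖v i‖)² ≤ #n Σ‖v i‖²`);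
* `negCountOpen_robust` — POINTWISE ROBUSTNESS: for Hermitian `A` there is `η > 0` such that every
  Hermitian `B` entrywise `η`-close to `A` has `n₋(A) ≤ n₋(B)` (Weyl counting stability
  `card_filter_lt_neg_le` of `WindowExtinction/Negative/SpectralFlowLocal.lean` below the least
  modulus of a negative eigenvalue of `A`);
* `negCountOpen_isOpen` — hence `{p | θ ≤ n₋(F p)}` is open for a continuous Hermitian family;
* `stub_negCountOpen` — the generalized tube lemma over `{x₀} × [lo, hi]`.

References: Horn–Johnson, *Matrix Analysis* (1985), Thm. 4.3.1 (Weyl) and §4.5 (Sylvester);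
Munkres, *Topology*, Lemma 26.8 (tube lemma).
-/

noncomputable section

namespace Summit.QuantumFields.QCD.Cruxes.WindowExtinction.FreeVolumeHeavyWitness

open Matrix
open Summit.QuantumFields.QCD.Theorems.ExtinctionBuildsQCD.Negative
open Summit.QuantumFields.QCD.Theorems.WindowExtinction.Negative
open scoped BigOperators

section Robust

variable {n : Type*} [Fintype n]

/-- **Entrywise bound ⇒ form bound.**  If `‖D i j‖ ≤ η` for all entries (`0 ≤ η`), then
`|Re⟨v, D v⟩| ≤ η · #n · Σ_i ‖v i‖²` (triangle inequality and `(Σ‖v i‖)² ≤ #n · Σ‖v i‖²`). -/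
theorem negCountOpen_abs_form_le (D : Matrix n n ℂ) {η : ℝ} (hη : 0 ≤ η)
    (hD : ∀ i j, ‖D i j‖ ≤ η) (v : n → ℂ) :
    |(star v ⬝ᵥ D *ᵥ v).re| ≤ η * Fintype.card n * ∑ i, ‖v i‖ ^ 2 := by
  have h1 : ∀ i, ‖(D *ᵥ v) i‖ ≤ η * ∑ j, ‖v j‖ := by
    intro i
    change ‖∑ j, D i j * v j‖ ≤ _
    rw [Finset.mul_sum]
    refine (norm_sum_le _ _).trans (Finset.sum_le_sum fun j _ => ?_)
    rw [norm_mul]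
    exact mul_le_mul_of_nonneg_right (hD i j) (norm_nonneg _)
  have h2 : ‖star v ⬝ᵥ D *ᵥ v‖ ≤ (∑ i, ‖v i‖) * (η * ∑ j, ‖v j‖) := by
    change ‖∑ i, star (v i) * (D *ᵥ v) i‖ ≤ _
    rw [Finset.sum_mul]
    refine (norm_sum_le _ _).trans (Finset.sum_le_sum fun i _ => ?_)
    rw [norm_mul, norm_star]
    exact mul_le_mul_of_nonneg_left (h1 i) (norm_nonneg _)
  have h3 : (∑ i, ‖v i‖) ^ 2 ≤ Fintype.card n * ∑ i, ‖v i‖ ^ 2 := by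
    have := sq_sum_le_card_mul_sum_sq (s := (Finset.univ : Finset n)) (f := fun i => ‖v i‖)
    simpa only [Finset.card_univ] using this
  calc |(star v ⬝ᵥ D *ᵥ v).re| ≤ ‖star v ⬝ᵥ D *ᵥ v‖ := Complex.abs_re_le_norm _
    _ ≤ (∑ i, ‖v i‖) * (η * ∑ j, ‖v j‖) := h2
    _ = η * (∑ i, ‖v i‖) ^ 2 := by ring
    _ ≤ η * (Fintype.card n * ∑ i, ‖v i‖ ^ 2) := mul_le_mul_of_nonneg_left h3 hη
    _ = η * Fintype.card n * ∑ i, ‖v i‖ ^ 2 := by ring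

variable [DecidableEq n]

/-- **Pointwise robustness of the negative count (lower semicontinuity in the entries).**  For a
Hermitian `A` there is `η > 0` such that every Hermitian `B` with `‖B i j − A i j‖ < η` for all
`i, j` has `n₋(A) ≤ n₋(B)`.  Proof: with `g` the least modulus of a negative eigenvalue of `A` and
`η = (g/2) / (#n + 1)`, the form of `B − A` is bounded by `(g/2) Σ‖v i‖²`
(`negCountOpen_abs_form_le`), and Weyl counting stability (`card_filter_lt_neg_le`) gives
`n₋(A) = #{λ_i(A) < −g/2} ≤ #{λ_i(B) < 0} = n₋(B)`. -/
theorem negCountOpen_robust {A : Matrix n n ℂ} (hA : A.IsHermitian) :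
    ∃ η : ℝ, 0 < η ∧ ∀ B : Matrix n n ℂ, B.IsHermitian → (∀ i j, ‖B i j - A i j‖ < η) →
      negRootCount A ≤ negRootCount B := by
  -- `g`: the least modulus of a negative eigenvalue of `A` (or `1` if there is none)
  let S : Finset n := Finset.univ.filter fun i => hA.eigenvalues i < 0
  let g : ℝ := if hS : S.Nonempty then S.inf' hS (fun i => -hA.eigenvalues i) else 1
  have hg : 0 < g := by
    simp only [g]
    split_ifs with hS
    · rw [Finset.lt_inf'_iff]
      intro i hi
      exact neg_pos.2 (Finset.mem_filter.1 hi).2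
    · exact one_pos
  have hgle : ∀ i, hA.eigenvalues i < 0 → g ≤ -hA.eigenvalues i := by
    intro i hi
    have hiS : i ∈ S := Finset.mem_filter.2 ⟨Finset.mem_univ _, hi⟩
    have hS : S.Nonempty := ⟨i, hiS⟩
    simp only [g, dif_pos hS]
    exact Finset.inf'_le (fun i => -hA.eigenvalues i) hiS
  refine ⟨g / 2 / (Fintype.card n + 1), by positivity, fun B hB hBA => ?_⟩
  -- the form of `B - A` is bounded by `(g/2) Σ‖v i‖²`
  have hE : ∀ v : n → ℂ, |(star v ⬝ᵥ (B - A) *ᵥ v).re| ≤ g / 2 * ∑ i, ‖v i‖ ^ 2 := by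
    intro v
    refine (negCountOpen_abs_form_le (B - A) (η := g / 2 / (Fintype.card n + 1)) (by positivity)
      (fun i j => by rw [Matrix.sub_apply]; exact (hBA i j).le) v).trans ?_
    have hS0 : 0 ≤ ∑ i, ‖v i‖ ^ 2 := Finset.sum_nonneg fun i _ => by positivity
    refine mul_le_mul_of_nonneg_right ?_ hS0
    rw [div_mul_eq_mul_div, div_le_iff₀ (by positivity)]
    nlinarith [hg, (Nat.cast_nonneg (Fintype.card n) : (0 : ℝ) ≤ Fintype.card n)]
  -- Weyl counting stability below the gap
  have h := card_filter_lt_neg_le hA hB (σ := 1) (δ := g / 2) (Or.inl rfl) hE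
  have e1 : (Finset.univ.filter fun i => (1 : ℝ) * hA.eigenvalues i < -(g / 2)) =
      Finset.univ.filter fun i => hA.eigenvalues i < 0 := by
    refine Finset.filter_congr fun i _ => ?_
    rw [one_mul]
    constructor
    · intro h'
      linarith
    · intro h'
      have := hgle i h'
      linarith
  have e2 : (Finset.univ.filter fun i => (1 : ℝ) * hB.eigenvalues i < 0) =
      Finset.univ.filter fun i => hB.eigenvalues i < 0 :=
    Finset.filter_congr fun i _ => by rw [one_mul]
  rw [e1, e2] at h
  rwa [negRootCount_eq_card hA, negRootCount_eq_card hB]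

/-- **Openness of a super-level set of the negative count.**  For a continuous family `F` of
Hermitian matrices on a topological space, `{p | θ ≤ n₋(F p)}` is open (pointwise robustness
`negCountOpen_robust` + continuity of the finitely many entries). -/
theorem negCountOpen_isOpen {P : Type*} [TopologicalSpace P] {F : P → Matrix n n ℂ}
    (hF : Continuous F) (hH : ∀ p, (F p).IsHermitian) (θ : ℕ) :
    IsOpen {p : P | θ ≤ negRootCount (F p)} := by
  rw [isOpen_iff_forall_mem_open]
  intro p₀ hp₀
  obtain ⟨η, hη, hrob⟩ := negCountOpen_robust (hH p₀)
  refine ⟨⋂ i, ⋂ j, {p : P | ‖F p i j - F p₀ i j‖ < η}, fun p hp => ?_,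
    isOpen_iInter_of_finite fun i => isOpen_iInter_of_finite fun j =>
      isOpen_lt ((hF.matrix_elem i j).sub continuous_const).norm continuous_const, ?_⟩
  · simp only [Set.mem_iInter, Set.mem_setOf_eq] at hp
    exact le_trans hp₀ (hrob _ (hH p) hp)
  · simp only [Set.mem_iInter, Set.mem_setOf_eq, sub_self, norm_zero]
    exact fun _ _ => hη

end Robust

/-! ## The stub -/

section Stub

/-- **STUB S9 `stub_negCountOpen` (lower semicontinuity of the negative count, with a uniform tube
over a compact probe interval).**  For a jointly continuous family `F x s` of Hermitian matrices
and a point `x₀` with `n₋(F x₀ s) ≥ θ` for all `s ∈ [lo, hi]`, some open `V ∋ x₀` has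
`n₋(F x s) ≥ θ` for all `x ∈ V`, `s ∈ [lo, hi]`.  Proof: `{(x, s) | θ ≤ n₋(F x s)}` is open
(`negCountOpen_isOpen`) and contains the compact `{x₀} × [lo, hi]`, so the generalized tube lemma
(`generalized_tube_lemma`) gives an open box `u × w` around it inside; take `V = u`. -/
theorem stub_negCountOpen :
    ∀ {X : Type} [TopologicalSpace X] {ι : Type} [Fintype ι] [DecidableEq ι] (F : X → ℝ → Matrix ι ι ℂ),
      Continuous (fun p : X × ℝ => F p.1 p.2) → (∀ x s, (F x s).IsHermitian) →
      ∀ (θ : ℕ) (x₀ : X) (lo hi : ℝ), (∀ s : ℝ, lo ≤ s → s ≤ hi → θ ≤ negRootCount (F x₀ s)) →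
        ∃ V : Set X, IsOpen V ∧ x₀ ∈ V ∧ ∀ x ∈ V, ∀ s : ℝ, lo ≤ s → s ≤ hi → θ ≤ negRootCount (F x s) := by
  intro X _ ι _ _ F hF hH θ x₀ lo hi hθ
  -- the open super-level set in `X × ℝ`
  have hO : IsOpen {p : X × ℝ | θ ≤ negRootCount (F p.1 p.2)} :=
    negCountOpen_isOpen (F := fun p : X × ℝ => F p.1 p.2) hF (fun p => hH p.1 p.2) θ
  -- it contains the compact slice `{x₀} × [lo, hi]`
  have hsub : ({x₀} : Set X) ×ˢ Set.Icc lo hi ⊆ {p : X × ℝ | θ ≤ negRootCount (F p.1 p.2)} := by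
    rintro ⟨x, s⟩ ⟨hx, hs⟩
    have hx' : x = x₀ := hx
    subst hx'
    exact hθ s hs.1 hs.2
  -- the generalized tube lemma
  obtain ⟨u, w, hu, -, hxu, hIw, huw⟩ :=
    generalized_tube_lemma isCompact_singleton isCompact_Icc hO hsub
  refine ⟨u, hu, hxu (Set.mem_singleton x₀), fun x hx s hlo hhi => ?_⟩
  have hmem : (x, s) ∈ {p : X × ℝ | θ ≤ negRootCount (F p.1 p.2)} :=
    huw (Set.mk_mem_prod hx (hIw ⟨hlo, hhi⟩))
  simpa only [Set.mem_setOf_eq] using hmem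

end Stub

end Summit.QuantumFields.QCD.Cruxes.WindowExtinction.FreeVolumeHeavyWitness

end
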